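import Summits.ABC.ABC.Theorems.DefiniteXiXiBoundUpgrade
import HarnessLib

/-!
# Crux `XiStrongBound` (stmt-ABC-11337), line SplitProof — the sector split (skeleton v4) as citable theorems

The line's skeleton v4 (`Cruxes/XiStrongBound/Lines/SplitProof.lean`, lead c1, 2026-08-16) proves the crux
`XiStrongBound` (`ξ(E_{a,b}; N/N⁻, N⁻) · ∏_{q ∣ N⁻} v_q(Δ_min) ≤ C_ε N^{2+ε}` at every admissible `N⁻`) by a
case split on `Squarefree N` (`N` the conductor of the Frey curve `E_{a,b}`; `Squarefree N` = semistable, else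
additive reduction at `2`):

* semistable sector: the `{2,3}`-quarantine **A′** (`ordProj[2] ξ · ordProj[3] ξ ≤ C_ε N^ε ∏_{q ∣ N, q ∤ N⁻} v_q(Δ_min)`
  for `Squarefree N` — the repaired statement C′ of the route crux `EisensteinQuarantine`, stmt-ABC-15023, after the
  census verdict `refuted-misstated` of refuter-rattack-stmt-ABC-15023-0, 2026-08-16T10:06Z: the 2-part of `ξ` outgrows
  the allowance by `2^{(0.65±0.07) log₂ N}` on additive-at-2 Frey curves and plateaus on semistable ones) times the route
  crux `SteinbergCore` (stmt-ABC-15024), multiplied out by the rev-12 algebra;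
* additive sector: the crux restricted to `¬ Squarefree N`, unsplit (**C**).

This file records that structure over the route decls, with complete proofs and no new definitions:

* `xi_mul_prod_le_of_split` — the pointwise algebra (`ξ = s · (ξ/s)` for the `{2,3}`-part `s ∣ ξ`,
  `∏_{q ∣ N} = ∏_{q ∣ N, q ∤ N⁻} · ∏_{q ∣ N⁻}`);
* `xiStrongBoundSemistable_of_quarantine` — **A′ ∧ SteinbergCore ⟹ the crux on the semistable sector**;
* `xiStrongBound_of_sectors` — **A′ → SteinbergCore → C → XiStrongBound** (the v4 composition; registered stub);
* `xiStrongBoundAdditive_of_xiStrongBound`, `eisensteinQuarantineSemistable_of_eisensteinQuarantine` — C is a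
  restriction of the crux and A′ a restriction of the route binder (so stmt-ABC-15023 as filed still closes A′);
* `xiStrongBound_iff_additive` — GIVEN A′ and `SteinbergCore`, the crux is EQUIVALENT to its additive sector C:
  modulo the semistable split, all that is left of stmt-ABC-11337 is `XiStrongBound` on Frey curves with `4 ∣ N`.
-/

-- `Summit.<Summit>.<Problem>` is the mandated summit-side namespace (CONVENTIONS §2); for the single-conjunct summit `ABC` the two coincide, so the duplicate `ABC.ABC` is deliberate.
set_option linter.dupNamespace false

noncomputable section

namespace Summit.ABC.ABC.Theorems.DefiniteXiXiStrongBoundSectorSplit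

open Literature.NumberTheory.EllipticCurves Literature.NumberTheory.Automorphic
open Summit.ABC.ABC.Theses.DefiniteXi

/-! ## The pointwise algebra of the split -/

/-- **Pointwise algebra of the split** (the rev-12 algebra of `closes`, one instance at a time): if
`s := ordProj[2] ξ · ordProj[3] ξ ≤ C₁ N^{ε/2} · ∏_{q ∣ N, q ∤ N⁻} v_q` and `(ξ / s) · ∏_{q ∣ N} v_q ≤ C₂ N^{2+ε/2}`
with `C₁ ≥ 0` and `N⁻ ∣ N ≠ 0`, then `ξ · ∏_{q ∣ N⁻} v_q ≤ C₁ C₂ N^{2+ε}`: `s ∣ ξ` (coprime prime powers), so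
`ξ = s · (ξ/s)`, and `∏_{q ∣ N} v_q = (∏_{q ∣ N, q ∤ N⁻} v_q) · ∏_{q ∣ N⁻} v_q` (`Finset.prod_sdiff`). [folklore] -/
theorem xi_mul_prod_le_of_split {ξ N Nm : ℕ} {v : ℕ → ℕ} {C₁ C₂ ε : ℝ} (hN : N ≠ 0) (hdvd : Nm ∣ N)
    (hC₁ : 0 ≤ C₁)
    (hA : ((ordProj[2] ξ * ordProj[3] ξ : ℕ) : ℝ) ≤
      C₁ * (N : ℝ) ^ (ε / 2) * ((∏ q ∈ N.primeFactors \ Nm.primeFactors, v q : ℕ) : ℝ))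
    (hB : ((ξ / (ordProj[2] ξ * ordProj[3] ξ) : ℕ) : ℝ) * ((∏ q ∈ N.primeFactors, v q : ℕ) : ℝ) ≤
      C₂ * (N : ℝ) ^ (2 + ε / 2)) :
    (ξ : ℝ) * ∏ q ∈ Nm.primeFactors, ((v q : ℕ) : ℝ) ≤ C₁ * C₂ * (N : ℝ) ^ (2 + ε) := by
  set s : ℕ := ordProj[2] ξ * ordProj[3] ξ with hs
  have hNpos : (0 : ℝ) < (N : ℝ) := by exact_mod_cast Nat.pos_of_ne_zero hN
  have hsub : Nm.primeFactors ⊆ N.primeFactors := Nat.primeFactors_mono hdvd hN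
  have hsdvd : s ∣ ξ := by
    rcases Nat.eq_zero_or_pos ξ with h0ξ | _
    · rw [h0ξ]; exact dvd_zero _
    · exact Nat.Coprime.mul_dvd_of_dvd_of_dvd
        (Nat.Coprime.pow _ _ (by norm_num : Nat.Coprime 2 3)) (Nat.ordProj_dvd ξ 2) (Nat.ordProj_dvd ξ 3)
  have hsc : (ξ : ℝ) = (s : ℝ) * ((ξ / s : ℕ) : ℝ) := by
    have : s * (ξ / s) = ξ := Nat.mul_div_cancel' hsdvd
    exact_mod_cast this.symm
  have hprod : ((∏ q ∈ N.primeFactors, v q : ℕ) : ℝ)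
      = ((∏ q ∈ N.primeFactors \ Nm.primeFactors, v q : ℕ) : ℝ) * ∏ q ∈ Nm.primeFactors, ((v q : ℕ) : ℝ) := by
    rw [← Nat.cast_prod, ← Nat.cast_mul, Finset.prod_sdiff hsub]
  have hL : (0 : ℝ) ≤ ((∏ q ∈ N.primeFactors \ Nm.primeFactors, v q : ℕ) : ℝ) := by positivity
  have hM : (0 : ℝ) ≤ ∏ q ∈ Nm.primeFactors, ((v q : ℕ) : ℝ) := by positivity
  have hc : (0 : ℝ) ≤ ((ξ / s : ℕ) : ℝ) := by positivity
  have hrpow1 : (0 : ℝ) ≤ (N : ℝ) ^ (ε / 2) := Real.rpow_nonneg hNpos.le _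
  have hNsplit : (N : ℝ) ^ (ε / 2) * (N : ℝ) ^ (2 + ε / 2) = (N : ℝ) ^ (2 + ε) := by
    rw [← Real.rpow_add hNpos]; ring_nf
  calc (ξ : ℝ) * ∏ q ∈ Nm.primeFactors, ((v q : ℕ) : ℝ)
      = (s : ℝ) * (((ξ / s : ℕ) : ℝ) * ∏ q ∈ Nm.primeFactors, ((v q : ℕ) : ℝ)) := by rw [hsc]; ring
    _ ≤ (C₁ * (N : ℝ) ^ (ε / 2) * ((∏ q ∈ N.primeFactors \ Nm.primeFactors, v q : ℕ) : ℝ))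
          * (((ξ / s : ℕ) : ℝ) * ∏ q ∈ Nm.primeFactors, ((v q : ℕ) : ℝ)) := by
        gcongr
    _ = C₁ * (N : ℝ) ^ (ε / 2) * (((ξ / s : ℕ) : ℝ) * ((∏ q ∈ N.primeFactors, v q : ℕ) : ℝ)) := by
        rw [hprod]; ring
    _ ≤ C₁ * (N : ℝ) ^ (ε / 2) * (C₂ * (N : ℝ) ^ (2 + ε / 2)) := by
        gcongr
    _ = C₁ * C₂ * (N : ℝ) ^ (2 + ε) := by rw [← hNsplit]; ring

/-! ## The semistable sector closes from the quarantine and the Steinberg core -/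

/-- **A′ ∧ SteinbergCore ⟹ the crux on the semistable sector.**  If the `{2,3}`-part of `ξ` is quarantined on
semistable Frey curves (A′: `ordProj[2] ξ · ordProj[3] ξ ≤ C_ε N^ε ∏_{q ∣ N, q ∤ N⁻} v_q(Δ_min)` whenever
`Squarefree N`) and `SteinbergCore` holds, then `ξ · ∏_{q ∣ N⁻} v_q(Δ_min) ≤ C_ε N^{2+ε}` for every SEMISTABLE
`E_{a,b}` and every admissible `N⁻` (both binders at `ε/2`, constants replaced by `max · 0`, then
`xi_mul_prod_le_of_split`). [folklore] -/
theorem xiStrongBoundSemistable_of_quarantine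
    (hA : ∀ ε : ℝ, 0 < ε → ∃ C : ℝ, ∀ a b : ℤ, IsCoprime a b → a * b * (a + b) ≠ 0 →
      ∀ (N : ℕ) [NeZero N], (freyCurve a b).conductorNorm ℤ = N → Squarefree N →
        ∀ Nm : ℕ, Odd Nm → Squarefree Nm → Odd Nm.primeFactors.card → Nm ∣ N →
          ((ordProj[2] (brandtXi (N / Nm) Nm (fun n => (freyCurve a b).LFunction n)) *
              ordProj[3] (brandtXi (N / Nm) Nm (fun n => (freyCurve a b).LFunction n)) : ℕ) : ℝ) ≤
            C * (N : ℝ) ^ ε *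
              ((∏ q ∈ N.primeFactors \ Nm.primeFactors,
                  ((freyCurve a b).minimalDiscriminantNorm ℤ).factorization q : ℕ) : ℝ))
    (hB : SteinbergCore) :
    ∀ ε : ℝ, 0 < ε → ∃ C : ℝ, ∀ a b : ℤ, IsCoprime a b → a * b * (a + b) ≠ 0 →
      ∀ (N : ℕ) [NeZero N], (freyCurve a b).conductorNorm ℤ = N → Squarefree N →
        ∀ Nm : ℕ, Odd Nm → Squarefree Nm → Odd Nm.primeFactors.card → Nm ∣ N →
          (brandtXi (N / Nm) Nm (fun n => (freyCurve a b).LFunction n) : ℝ) *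
              ∏ q ∈ Nm.primeFactors, ((((freyCurve a b).minimalDiscriminantNorm ℤ).factorization q : ℕ) : ℝ) ≤
            C * (N : ℝ) ^ (2 + ε) := by
  intro ε hε
  obtain ⟨C₁, hC₁⟩ := hA (ε / 2) (by linarith)
  obtain ⟨C₂, hC₂⟩ := hB (ε / 2) (by linarith)
  refine ⟨max C₁ 0 * max C₂ 0, ?_⟩
  intro a b hab h0 N _ hN hN2 Nm hodd hsq hcard hdvd
  have hNpos : (0 : ℝ) < (N : ℝ) := by exact_mod_cast Nat.pos_of_ne_zero (NeZero.ne N)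
  have hA₀ := hC₁ a b hab h0 N hN hN2 Nm hodd hsq hcard hdvd
  have hB₀ := hC₂ a b hab h0 N hN Nm hodd hsq hcard hdvd
  have hL : (0 : ℝ) ≤ ((∏ q ∈ N.primeFactors \ Nm.primeFactors,
      ((freyCurve a b).minimalDiscriminantNorm ℤ).factorization q : ℕ) : ℝ) := by positivity
  have hrpow1 : (0 : ℝ) ≤ (N : ℝ) ^ (ε / 2) := Real.rpow_nonneg hNpos.le _
  have hrpow2 : (0 : ℝ) ≤ (N : ℝ) ^ (2 + ε / 2) := Real.rpow_nonneg hNpos.le _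
  have hA₁ := hA₀.trans (mul_le_mul_of_nonneg_right
    (mul_le_mul_of_nonneg_right (le_max_left C₁ 0) hrpow1) hL)
  have hB₁ := hB₀.trans (mul_le_mul_of_nonneg_right (le_max_left C₂ 0) hrpow2)
  exact xi_mul_prod_le_of_split (NeZero.ne N) hdvd (le_max_right C₁ 0) hA₁ hB₁

/-! ## The v4 composition: both sectors -/

/-- **A′ → SteinbergCore → C → XiStrongBound** (the composition `XiStrongBound_of` of skeleton v4 with its three
stubs as hypotheses; registered stub of stmt-ABC-11337): case split on `Squarefree N` — the semistable sector is
`xiStrongBoundSemistable_of_quarantine`, the additive sector (`¬ Squarefree N`, i.e. `4 ∣ N`, additive reduction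
at `2`) is hypothesis C verbatim; constants merged by `max`. [folklore] -/
theorem xiStrongBound_of_sectors :
    (∀ ε : ℝ, 0 < ε → ∃ C : ℝ, ∀ a b : ℤ, IsCoprime a b → a * b * (a + b) ≠ 0 →
      ∀ (N : ℕ) [NeZero N], (freyCurve a b).conductorNorm ℤ = N → Squarefree N →
        ∀ Nm : ℕ, Odd Nm → Squarefree Nm → Odd Nm.primeFactors.card → Nm ∣ N →
          ((ordProj[2] (brandtXi (N / Nm) Nm (fun n => (freyCurve a b).LFunction n)) *
              ordProj[3] (brandtXi (N / Nm) Nm (fun n => (freyCurve a b).LFunction n)) : ℕ) : ℝ) ≤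
            C * (N : ℝ) ^ ε *
              ((∏ q ∈ N.primeFactors \ Nm.primeFactors,
                  ((freyCurve a b).minimalDiscriminantNorm ℤ).factorization q : ℕ) : ℝ)) →
    SteinbergCore →
    (∀ ε : ℝ, 0 < ε → ∃ C : ℝ, ∀ a b : ℤ, IsCoprime a b → a * b * (a + b) ≠ 0 →
      ∀ (N : ℕ) [NeZero N], (freyCurve a b).conductorNorm ℤ = N → ¬ Squarefree N →
        ∀ Nm : ℕ, Odd Nm → Squarefree Nm → Odd Nm.primeFactors.card → Nm ∣ N →
          (brandtXi (N / Nm) Nm (fun n => (freyCurve a b).LFunction n) : ℝ) *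
              ∏ q ∈ Nm.primeFactors, ((((freyCurve a b).minimalDiscriminantNorm ℤ).factorization q : ℕ) : ℝ) ≤
            C * (N : ℝ) ^ (2 + ε)) →
    XiStrongBound := by
  intro hA hB hC ε hε
  obtain ⟨C₁, hC₁⟩ := xiStrongBoundSemistable_of_quarantine hA hB ε hε
  obtain ⟨C₃, hC₃⟩ := hC ε hε
  refine ⟨max C₁ C₃, ?_⟩
  intro a b hab h0 N _ hN Nm hodd hsq hcard hdvd
  have hNpos : (0 : ℝ) < (N : ℝ) := by exact_mod_cast Nat.pos_of_ne_zero (NeZero.ne N)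
  have hpow : (0 : ℝ) ≤ (N : ℝ) ^ (2 + ε) := Real.rpow_nonneg hNpos.le _
  by_cases hN2 : Squarefree N
  · exact (hC₁ a b hab h0 N hN hN2 Nm hodd hsq hcard hdvd).trans
      (mul_le_mul_of_nonneg_right (le_max_left _ _) hpow)
  · exact (hC₃ a b hab h0 N hN hN2 Nm hodd hsq hcard hdvd).trans
      (mul_le_mul_of_nonneg_right (le_max_right _ _) hpow)

/-! ## Necessity: the two sector statements are restrictions -/

/-- **C is a restriction of the crux**: `XiStrongBound` gives its additive sector verbatim (drop the hypothesis
`¬ Squarefree N`). [folklore] -/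
theorem xiStrongBoundAdditive_of_xiStrongBound (h : XiStrongBound) :
    ∀ ε : ℝ, 0 < ε → ∃ C : ℝ, ∀ a b : ℤ, IsCoprime a b → a * b * (a + b) ≠ 0 →
      ∀ (N : ℕ) [NeZero N], (freyCurve a b).conductorNorm ℤ = N → ¬ Squarefree N →
        ∀ Nm : ℕ, Odd Nm → Squarefree Nm → Odd Nm.primeFactors.card → Nm ∣ N →
          (brandtXi (N / Nm) Nm (fun n => (freyCurve a b).LFunction n) : ℝ) *
              ∏ q ∈ Nm.primeFactors, ((((freyCurve a b).minimalDiscriminantNorm ℤ).factorization q : ℕ) : ℝ) ≤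
            C * (N : ℝ) ^ (2 + ε) := by
  intro ε hε
  obtain ⟨C, hC⟩ := h ε hε
  exact ⟨C, fun a b hab h0 N _ hN _ Nm hodd hsq hcard hdvd => hC a b hab h0 N hN Nm hodd hsq hcard hdvd⟩

/-- **A′ is a restriction of the route binder**: `EisensteinQuarantine` (stmt-ABC-15023, as filed for all coprime
`a, b`) gives its semistable sector A′ verbatim — so a proof of the route item still closes the line's stub, while
the census verdict concerns only the instances A′ discards. [folklore] -/
theorem eisensteinQuarantineSemistable_of_eisensteinQuarantine (h : EisensteinQuarantine) :
    ∀ ε : ℝ, 0 < ε → ∃ C : ℝ, ∀ a b : ℤ, IsCoprime a b → a * b * (a + b) ≠ 0 →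
      ∀ (N : ℕ) [NeZero N], (freyCurve a b).conductorNorm ℤ = N → Squarefree N →
        ∀ Nm : ℕ, Odd Nm → Squarefree Nm → Odd Nm.primeFactors.card → Nm ∣ N →
          ((ordProj[2] (brandtXi (N / Nm) Nm (fun n => (freyCurve a b).LFunction n)) *
              ordProj[3] (brandtXi (N / Nm) Nm (fun n => (freyCurve a b).LFunction n)) : ℕ) : ℝ) ≤
            C * (N : ℝ) ^ ε *
              ((∏ q ∈ N.primeFactors \ Nm.primeFactors,
                  ((freyCurve a b).minimalDiscriminantNorm ℤ).factorization q : ℕ) : ℝ) := by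
  intro ε hε
  obtain ⟨C, hC⟩ := h ε hε
  exact ⟨C, fun a b hab h0 N _ hN _ Nm hodd hsq hcard hdvd => hC a b hab h0 N hN Nm hodd hsq hcard hdvd⟩

/-! ## Where the item stands modulo the semistable split -/

/-- **Given A′ and `SteinbergCore`, the crux is equivalent to its additive sector C.**  Modulo the semistable
split, all that is left of stmt-ABC-11337 is `XiStrongBound` on Frey curves with additive reduction at `2`
(`4 ∣ N`) — the sector where the `{2,3}`-quarantine is numerically false and no split is proposed. [folklore] -/
theorem xiStrongBound_iff_additive
    (hA : ∀ ε : ℝ, 0 < ε → ∃ C : ℝ, ∀ a b : ℤ, IsCoprime a b → a * b * (a + b) ≠ 0 →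
      ∀ (N : ℕ) [NeZero N], (freyCurve a b).conductorNorm ℤ = N → Squarefree N →
        ∀ Nm : ℕ, Odd Nm → Squarefree Nm → Odd Nm.primeFactors.card → Nm ∣ N →
          ((ordProj[2] (brandtXi (N / Nm) Nm (fun n => (freyCurve a b).LFunction n)) *
              ordProj[3] (brandtXi (N / Nm) Nm (fun n => (freyCurve a b).LFunction n)) : ℕ) : ℝ) ≤
            C * (N : ℝ) ^ ε *
              ((∏ q ∈ N.primeFactors \ Nm.primeFactors,
                  ((freyCurve a b).minimalDiscriminantNorm ℤ).factorization q : ℕ) : ℝ))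
    (hB : SteinbergCore) :
    XiStrongBound ↔
      ∀ ε : ℝ, 0 < ε → ∃ C : ℝ, ∀ a b : ℤ, IsCoprime a b → a * b * (a + b) ≠ 0 →
        ∀ (N : ℕ) [NeZero N], (freyCurve a b).conductorNorm ℤ = N → ¬ Squarefree N →
          ∀ Nm : ℕ, Odd Nm → Squarefree Nm → Odd Nm.primeFactors.card → Nm ∣ N →
            (brandtXi (N / Nm) Nm (fun n => (freyCurve a b).LFunction n) : ℝ) *
                ∏ q ∈ Nm.primeFactors, ((((freyCurve a b).minimalDiscriminantNorm ℤ).factorization q : ℕ) : ℝ) ≤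
              C * (N : ℝ) ^ (2 + ε) :=
  ⟨xiStrongBoundAdditive_of_xiStrongBound, xiStrongBound_of_sectors hA hB⟩

end Summit.ABC.ABC.Theorems.DefiniteXiXiStrongBoundSectorSplit

end
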